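import Summits.CriticalPhenomena.PercolationContinuityZ3.Theorems.Transplant.SkelNegBParamsResidualsAF
import Summits.CriticalPhenomena.PercolationContinuityZ3.Theorems.Transplant.SkelNegBChoiceAllTA
import Summits.CriticalPhenomena.PercolationContinuityZ3.Theorems.Transplant.SkelNegBParamsSlotsSUA
import HarnessLib

/-!
# N1 params, chain of record `NegB` — **SLOT LEDGER (ζ′) v3: THE K-SLOTS** (the y′-face bridge index `c` moved INSIDE the κ-binder)
p5-g12 located (lane INBOX 2026-08-22T09:17:13Z) that the bridge index `c` of the F pair must be κ-DEPENDENT (`c ≥ NrF′ + 1`, and the y′-face along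
counts reach `≈ 600·Kq κ`), while slot-ledger v2 bound `c : ℕ` OUTSIDE the κ-λ of the node's dischargers; lead (g8) 09:18:25Z framed and the design owner
p3-g12 09:38:09Z RULED **slot-ledger (ζ′) v3**: `cK κ := 1000·Kq κ + 1` inside three K-slots, tuple
**`negChoiceAllOTA (KS.gT 0 KS.gxAK) (KS.fT 0 KS.fxA) (KS.PR 0 Px) (NegB.SUA NegB.exAFK mx)`** (Px general, node value `KS.PxFK`; mx general, node value
`NegB.mxRA`; mk = 0), every re-instantiation POINTWISE in κ over the landed c-generic lemmas.  This file (stmt-g17, ledger keeper) supplies exactly that: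
* `NegB.cK := NegB.cFA` (stmt-g16's `cFA κ = 1000·Kq κ + 1`, ResidualsA p318016 — REUSED, not re-declared), `cK_eq`;
* the K-slots **`KS.gxAK`** (`:= fun κ … D => KS.gxA (cK κ) κ … D`), **`KS.PxFK`** (`:= fun κ … D => KS.PxF (cK κ) 0 κ … D`), **`NegB.exAFK`**
  (`:= fun κ … D g f => NegB.exAF (cK κ) κ … D g f`) with the pointwise unfoldings `gxAK_eq`, `gT_gxAK`, `PxFK_eq`, `PR_PxFK`, `exAFK_eq`, `SUA_exAFK`
  (all `rfl`, so re-instantiations are `rw`-free);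
* the pointwise facts at `c := cK κ`: `mem_PxFK`, `ML_floorsAK`, `hex_exAFK`, `floors_exAFK`, `exR2_le_exAFK`, `hc_cK` (`Nr + 1 ≤ 1000·Kq → Nr + 1 ≤ cK κ`);
* the ∀-form servers the three v3 corollaries quote: **`Hle_exAFK`** (p5's `…_of_exA_le` / p3's `…_of_le` `hex` shape: `exA ≤ exAFK` at `(gT 0 gxAK, fT 0 fxA)`),
  **`HML_gxAK`** (p3's `hML` shape: `22000·Kq·(RA′ 0+2) ≤ ML (gT 0 gxAK)` ∧ `64·(nBR 0 + ℓBR 0 + |hBR 0|) ≤ ML (gT 0 gxAK)`), and in the (F) glue's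
  `(… O : OutO V)`-form (hp-8 `…_of_floors (cK) (gx fx Px ex mx) (HPx Hmx Hex HSF) …` at `gx := gxAK`, `Px := PxFK`, `ex := exAFK`): **`HPx_K`**, **`Hex_K`**,
  **`HSF_K`** (`Hmx` at `mx := mxRA` is `NegB.Hmx_mxRA KS.gxAK KS.fxA`, GlueSlotsAF p323873).
builds on p205010 (kernel theorem, internal audit signed; external expert review pending) — nothing in this file uses p205010; NOTHING is claimed about the node
`SamePDropOfSkeletonNeg₁` (OPEN); definitions and bookkeeping only.
Lane `prim-bschramm-*`, seat `prim-bschramm-stmt` (gen 17); helper file (`--supports stmt-CriticalPhenomena-4575 --as helper`); ledger HOME/prim-bschramm-stmt/NEG-PARAMS.md v0.19d.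
[cite: KozmaNitzan2024, §4 Theorem 6 (pp. 25–31): the order of constants] [cite: MartineauTassion2017, §4.1]
-/

noncomputable section

open scoped Classical

namespace Summit.CriticalPhenomena.PercolationContinuityZ3.Theorems.Transplant

namespace PlanarSkeletonNeg

namespace NegB

open Literature.Probability.Percolation Literature.Probability.LatticeModels SimpleGraph
open SkelConc (Consts)
open Skelφ.StepI (DataN OutO)
open Neg

/-! ## §1 The κ-dependent bridge index and the three K-slots -/

/-- **THE κ-DEPENDENT y′-FACE BRIDGE INDEX OF SLOT-LEDGER v3**: `cK κ := 1000·Kq κ + 1` — by definition stmt-g16's `cFA` (reused). [this work] -/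
def cK : Consts → ℕ := cFA

/-- `cK κ = 1000·Kq κ + 1`, `cK = cFA`, and `1001 ≤ cK κ`. [folklore] -/
theorem cK_eq (κ : Consts) : cK κ = 1000 * Neg.Kq κ + 1 ∧ cK κ = cFA κ ∧ 1001 ≤ cK κ :=
  ⟨(cFA_eq κ).1, rfl, (cFA_eq κ).2⟩

/-- Any count with `Nr + 1 ≤ 1000·Kq` (e.g. the y′-face's `NrY + 1 ≤ 600·Kq`) satisfies the bridge-offset index bound `Nr + 1 ≤ cK κ`. [folklore] -/
theorem hc_cK (κ : Consts) {Nr : ℕ} (hNr : Nr + 1 ≤ 1000 * Neg.Kq κ) : Nr + 1 ≤ cK κ := by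
  rw [(cK_eq κ).1]; omega

namespace KS

/-- **THE BOX RESIDUAL K-SLOT** `gxAK := (κ ↦ gxA (cK κ))`. [this work] -/
def gxAK : Neg.FSlot := fun κ _ _ _ _ _ Φ t p D => gxA (cK κ) κ Φ t p D

/-- **THE EXTRA-PAIR K-SLOT** `PxFK := (κ ↦ PxF (cK κ) 0)` (the y′-face bridge pair at the κ-dependent index, kit slot `mk = 0`). [this work] -/
def PxFK : PSlot := fun κ _ _ _ _ _ Φ t p D => PxF (cK κ) 0 κ Φ t p D

end KS

/-- **THE EXCESS K-SLOT** `exAFK := (κ ↦ exAF (cK κ))`. [this work] -/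
def exAFK : GSlot := fun κ _ _ _ _ _ Φ t p D g f => exAF (cK κ) κ Φ t p D g f

/-! ## §2 Pointwise unfoldings (all `rfl`) and the pointwise facts at `c := cK κ` -/

section Pointwise

variable (κ : Consts) {V : Type} [DecidableEq V] [Countable V] {G : SimpleGraph V} [G.LocallyFinite] (Φ : PlanarSkeletonNeg G) (t : V)
  (p : unitInterval) (D : DataN V) (g f mk : ℕ) (mx : GSlot) (q : unitInterval)

/-- `gxAK κ … = gxA (cK κ) κ …` (rfl). [folklore] -/
theorem KS.gxAK_eq : KS.gxAK κ Φ t p D = KS.gxA (cK κ) κ Φ t p D := rfl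

/-- `gT mk gxAK κ … = gT mk (gxA (cK κ)) κ …` (rfl). [folklore] -/
theorem KS.gT_gxAK : KS.gT mk KS.gxAK κ Φ t p D = KS.gT mk (KS.gxA (cK κ)) κ Φ t p D := by
  unfold KS.gT KS.gxAK; rfl

/-- `PxFK κ … = PxF (cK κ) 0 κ …` (rfl). [folklore] -/
theorem KS.PxFK_eq : KS.PxFK κ Φ t p D = KS.PxF (cK κ) 0 κ Φ t p D := rfl

/-- `PR mk PxFK κ … = PR mk (PxF (cK κ) 0) κ …` (rfl). [folklore] -/
theorem KS.PR_PxFK : KS.PR mk KS.PxFK κ Φ t p D = KS.PR mk (KS.PxF (cK κ) 0) κ Φ t p D := by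
  unfold KS.PR KS.PxFK; rfl

/-- `exAFK κ … g f = exAF (cK κ) κ … g f` (rfl), the literal `exA + (r₀A 0 (RBF (cK κ) 0) + 1)`, and `exA ≤ exAFK`. [folklore] -/
theorem exAFK_eq : exAFK κ Φ t p D g f = exAF (cK κ) κ Φ t p D g f ∧
    exAFK κ Φ t p D g f = exA κ Φ t p D g f + (KS.r₀A Φ t D 0 (KS.RBF κ Φ t p D (cK κ) 0) + 1) ∧ exA κ Φ t p D g f ≤ exAFK κ Φ t p D g f :=
  ⟨rfl, (exAF_eq κ Φ t p D (cK κ) g f).1, (exAF_eq κ Φ t p D (cK κ) g f).2⟩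

/-- `SUA exAFK mx κ … g f q = SUA (exAF (cK κ)) mx κ … g f q` (rfl). [folklore] -/
theorem SUA_exAFK : SUA exAFK mx κ Φ t p D g f q = SUA (exAF (cK κ)) mx κ Φ t p D g f q := by
  unfold SUA exAFK; rfl

/-- The y′-face bridge pair at the κ-dependent index is in `PR 0 PxFK`. [folklore] -/
theorem KS.mem_PxFK : (KS.MBF κ Φ t p D (cK κ) 0, KS.nBF κ Φ t p D (cK κ) 0) ∈ (KS.PR 0 KS.PxFK κ Φ t p D).1 :=
  KS.mem_PxF κ Φ t p D (cK κ) 0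

/-- **`ML_floorsA` at the K-slot**: the five `M_L` floors at `g := gT 0 gxAK` (incl. `16·S_F (cK κ) 0 ≤ M_L`, `64·S_F (cK κ) 0 ≤ M_L`). [folklore] -/
theorem KS.ML_floorsAK : 30000 * Neg.Kq κ * (KS.RA' κ Φ t p D 0 + 2) ≤ ML κ Φ t p D (KS.gT 0 KS.gxAK κ Φ t p D) ∧
    64 * (KS.nBR κ Φ t p D 0 + KS.ℓBR κ Φ t p D 0 + (KS.hBR κ Φ t p D 0).natAbs) ≤ ML κ Φ t p D (KS.gT 0 KS.gxAK κ Φ t p D) ∧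
    64 * KS.SF κ Φ t p D (cK κ) 0 ≤ ML κ Φ t p D (KS.gT 0 KS.gxAK κ Φ t p D) ∧ 16 * KS.SF κ Φ t p D (cK κ) 0 ≤ ML κ Φ t p D (KS.gT 0 KS.gxAK κ Φ t p D) ∧
    22000 * (KS.RA' κ Φ t p D 0 + 2) ≤ ML κ Φ t p D (KS.gT 0 KS.gxAK κ Φ t p D) := by
  rw [KS.gT_gxAK]; exact KS.ML_floorsA κ Φ t p D (cK κ)

/-- **The glue's `hex` at `ex := exAFK`**: `exA ≤ exAFK` and `r₀A 0 (R (scale (MBF (cK κ) 0) (nBF (cK κ) 0))) + 1 ≤ exAFK`. [folklore] -/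
theorem hex_exAFK : exA κ Φ t p D g f ≤ exAFK κ Φ t p D g f ∧
    KS.r₀A Φ t D 0 (D.R (D.scale t (KS.MBF κ Φ t p D (cK κ) 0) (KS.nBF κ Φ t p D (cK κ) 0))) + 1 ≤ exAFK κ Φ t p D g f :=
  hex_exAF κ Φ t p D (cK κ) g f

/-- **`floors_exA` transported to `exAFK`** (same nine conjuncts). [folklore] -/
theorem floors_exAFK :
    KS.r₀A Φ t D 0 (Rb κ Φ t p D) + 1 ≤ exAFK κ Φ t p D g f ∧ KS.r₀A Φ t D 0 (Rl κ Φ t p D g f) + 1 ≤ exAFK κ Φ t p D g f ∧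
    Rl κ Φ t p D g f + 1 ≤ exAFK κ Φ t p D g f ∧ Rb κ Φ t p D + 1 ≤ exAFK κ Φ t p D g f ∧
    Yb κ Φ t p D g f + 1000 * Skelφ.shearUnit (nL κ Φ t p D g f) (hL κ Φ t p D g f) + 1 ≤ exAFK κ Φ t p D g f ∧
    exC κ Φ t p D g f ≤ exAFK κ Φ t p D g f ∧ KS.RlevA κ Φ t p D 0 + KS.reachA t D 0 ≤ exAFK κ Φ t p D g f ∧
    KS.r₀A Φ t D 0 (Rl κ Φ t p D g f) ≤ exAFK κ Φ t p D g f ∧ Yb κ Φ t p D g f + 11055 * nL κ Φ t p D g f + 1000 * ℓL κ Φ t p D g f + 20 ≤ exAFK κ Φ t p D g f :=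
  floors_exAF κ Φ t p D (cK κ) g f

/-- `exR2 ≤ exAFK` and `exCA ≤ exAFK`. [folklore] -/
theorem exR2_le_exAFK : exR2 κ Φ t p D g f ≤ exAFK κ Φ t p D g f ∧ exCA κ Φ t p D g f ≤ exAFK κ Φ t p D g f :=
  exR2_le_exAF κ Φ t p D (cK κ) g f

/-- `floorsK_exA` transported to `exAFK`: `Yb + 1000·Kq·U + 1 ≤ exAFK` (the (R) run floor `hfloorsK`). [folklore] -/
theorem floorsK_exAFK : Yb κ Φ t p D g f + 1000 * Neg.Kq κ * Skelφ.shearUnit (nL κ Φ t p D g f) (hL κ Φ t p D g f) + 1 ≤ exAFK κ Φ t p D g f :=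
  (floorsK_exA κ Φ t p D g f).1.trans (exAF_eq κ Φ t p D (cK κ) g f).2

end Pointwise

/-! ## §3 The ∀-form servers quoted by the v3 corollaries -/

/-- **p5's `hle` / p3's `hex` at the K-slots**: `exA ≤ exAFK` at `(gT 0 gxAK, fT 0 fxA)`, pointwise in κ. [folklore] -/
theorem Hle_exAFK :
    ∀ (κ : Consts) {V : Type} [DecidableEq V] [Countable V] {G : SimpleGraph V} [G.LocallyFinite] (Φ : PlanarSkeletonNeg G) (t : V)
      (p : unitInterval) (D : DataN V),
      exA κ Φ t p D (KS.gT 0 KS.gxAK κ Φ t p D) (KS.fT 0 KS.fxA κ Φ t p D) ≤ exAFK κ Φ t p D (KS.gT 0 KS.gxAK κ Φ t p D) (KS.fT 0 KS.fxA κ Φ t p D) :=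
  fun κ _ _ _ _ _ Φ t p D => (exAF_eq κ Φ t p D (cK κ) _ _).2

/-- **p3's `hML` at the K-slot**: `22000·Kq·(RA′ 0 + 2) ≤ M_L` and `64·(n_b + ℓ_b + |h_b|) ≤ M_L` at `g := gT 0 gxAK`, pointwise in κ. [folklore] -/
theorem HML_gxAK :
    ∀ (κ : Consts) {V : Type} [DecidableEq V] [Countable V] {G : SimpleGraph V} [G.LocallyFinite] (Φ : PlanarSkeletonNeg G) (t : V)
      (p : unitInterval) (D : DataN V),
      22000 * Neg.Kq κ * (KS.RA' κ Φ t p D 0 + 2) ≤ ML κ Φ t p D (KS.gT 0 KS.gxAK κ Φ t p D) ∧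
        64 * (KS.nBR κ Φ t p D 0 + KS.ℓBR κ Φ t p D 0 + (KS.hBR κ Φ t p D 0).natAbs) ≤ ML κ Φ t p D (KS.gT 0 KS.gxAK κ Φ t p D) := by
  intro κ _ _ _ _ _ Φ t p D
  obtain ⟨h1, h2, -⟩ := KS.ML_floorsAK κ Φ t p D
  refine ⟨le_trans ?_ h1, h2⟩
  exact Nat.mul_le_mul_right _ (Nat.mul_le_mul_right _ (by norm_num))

/-- **The (F) glue's `HPx` at `Px := PxFK`**: the bridge pair `(MBF (cK κ) 0, nBF (cK κ) 0)` of the merged record is in `PR 0 PxFK`. [folklore] -/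
theorem HPx_K :
    ∀ (κ : Consts) {V : Type} [DecidableEq V] [Countable V] {G : SimpleGraph V} [G.LocallyFinite] (Φ : PlanarSkeletonNeg G) (t : V) (p : unitInterval)
      (O : OutO V),
      (KS.MBF κ Φ t p O.merged (cK κ) 0, KS.nBF κ Φ t p O.merged (cK κ) 0) ∈ (KS.PR 0 KS.PxFK κ Φ t p O.merged).1 :=
  fun κ _ _ _ _ _ Φ t p O => KS.mem_PxF κ Φ t p O.merged (cK κ) 0

/-- **The (F) glue's `Hex` at `ex := exAFK`** (any width slots `gx fx`). [folklore] -/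
theorem Hex_K (gx fx : Neg.FSlot) :
    ∀ (κ : Consts) {V : Type} [DecidableEq V] [Countable V] {G : SimpleGraph V} [G.LocallyFinite] (Φ : PlanarSkeletonNeg G) (t : V) (p : unitInterval)
      (O : OutO V),
      exA κ Φ t p O.merged (gOf κ Φ t p O (KS.gT 0 gx)) (fOf κ Φ t p O (KS.fT 0 fx)) ≤ exAFK κ Φ t p O.merged (gOf κ Φ t p O (KS.gT 0 gx)) (fOf κ Φ t p O (KS.fT 0 fx)) ∧
      KS.r₀A Φ t O.merged 0 (O.merged.R (O.merged.scale t (KS.MBF κ Φ t p O.merged (cK κ) 0) (KS.nBF κ Φ t p O.merged (cK κ) 0))) + 1 ≤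
        exAFK κ Φ t p O.merged (gOf κ Φ t p O (KS.gT 0 gx)) (fOf κ Φ t p O (KS.fT 0 fx)) :=
  fun κ _ _ _ _ _ Φ t p O => hex_exAF κ Φ t p O.merged (cK κ) _ _

/-- **The (F) glue's `HSF` at `gx := gxAK`**: `16·S_F (cK κ) 0 ≤ M_L (gT 0 gxAK)` at the merged record. [folklore] -/
theorem HSF_K :
    ∀ (κ : Consts) {V : Type} [DecidableEq V] [Countable V] {G : SimpleGraph V} [G.LocallyFinite] (Φ : PlanarSkeletonNeg G) (t : V) (p : unitInterval)
      (O : OutO V),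
      16 * KS.SF κ Φ t p O.merged (cK κ) 0 ≤ ML κ Φ t p O.merged (gOf κ Φ t p O (KS.gT 0 KS.gxAK)) := by
  intro κ _ _ _ _ _ Φ t p O
  have e : gOf κ Φ t p O (KS.gT 0 KS.gxAK) = KS.gT 0 (KS.gxA (cK κ)) κ Φ t p O.merged := KS.gT_gxAK κ Φ t p O.merged 0
  rw [e]; exact (KS.ML_floorsA κ Φ t p O.merged (cK κ)).2.2.2.1

end NegB

end PlanarSkeletonNeg

end Summit.CriticalPhenomena.PercolationContinuityZ3.Theorems.Transplant

end
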